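import Literature.IUT.HodgeTheaters.PuncturedEllipticCoveringsArrowClaimsOfLawsIndices
import HarnessLib

/-!
# [IUTchI] §1 p. 38 — `Gal(X̲→/C̲) ≅ ℤ/2lℤ` and `Gal(C̲→/C̲) ≅ ℤ/lℤ` are CYCLIC: the last two clauses DERIVED

Mochizuki, *Inter-universal Teichmüller theory I*, kurims manuscript (May 2020), §1 p. 38
[cite: Mochizuki2012, IUTchI §1 p.38] (D-0012 claim key, status disputed).  PROOF-ONLY; file B5 of the
«hA re-grounding» series (abc-iut-L5-lead RULINGS #58 (10) GO); companion of `PuncturedEllipticCoverings.lean`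
(p404449) and of B1–B4 (`…ArrowClaimsOfLaws.lean` p444784, `…Index.lean` p445944, `…Normal.lean` p447007,
`…Indices.lean`).  No `def`, no instance, no new `Prop` fact.

Print (p. 38 l. 34–36): "we have `Gal(C̲→/C̲) ≅ ℤ/lℤ`, `Gal(X̲/C̲) ≅ ℤ/2ℤ`, and
`Gal(X̲→/C̲) ⥲ Gal(X̲/C̲) × Gal(C̲→/C̲) ≅ ℤ/2lℤ`."

WHAT IS PROVED (laws (L0) (L1) (L2a) (L2c) (L3) (L4) and `hι` as in B1/B2):
* **`CuspGalois.galX_cyclic_of_laws`** = the typed clause `ArrowCoveringClaims.galX_cyclic` (`Π_C̲/Π_{X̲→}` is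
  cyclic): `Δ_C̲/jKer = Δ_ε⁺ × Gal(X̲/C̲)` is abelian (B4) of order `2l`, the classes of a topological generator
  `z` of `I_ε′` and of `ι̲^l` have the coprime orders `l` and `2`, so their product generates
  (`Commute.orderOf_mul_eq_mul_orderOf_of_coprime`, `isCyclic_of_orderOf_eq_card`), and
  `Δ_C̲/jKer ↠ Π_C̲/Π_{X̲→}` since `Π_C̲ = Π_{X̲→} · Δ_C̲`;
* **`CuspGalois.galC_cyclic_of_laws`** = the typed clause `ArrowCoveringClaims.galC_cyclic` (a quotient of the
  former).

HONEST FRAMING: nothing here asserts abc proved or refuted or takes a side on [IUTchIII] Cor. 3.12; a clause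
derived under named laws is an implication, not a discharge of the laws; typed ≠ inhabited ≠ discharged.
-/

namespace Literature.IUT.HodgeTheaters

namespace PuncturedEllipticData

open scoped Pointwise
open Topology Literature.AnabelianGeometry.AbsoluteAnabelian

universe u

variable {D : PuncturedEllipticData.{u}}

namespace CuspGalois

variable (C : D.CuspGalois)

/-! ### Cyclicity of `Π_C̲/Π_{X̲→}` and `Π_C̲/Π_{C̲→}` -/

include C in
/-- **[IUTchI] §1 p. 38 — the typed clause `ArrowCoveringClaims.galX_cyclic` (`Gal(X̲→/C̲) ≅ ℤ/2lℤ` is CYCLIC)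
DERIVED**: `Δ_C̲/jKer` is abelian of order `2l`, the classes of a generator `z` of `I_ε′` and of `ι̲^l` have
coprime orders `l` and `2`, so their product generates; and `Δ_C̲/jKer ↠ Π_C̲/Π_{X̲→}`.
([IUTchI] §1 p.38) [claim: Mochizuki2012, status: disputed] -/
theorem galX_cyclic_of_laws
    (hfin : D.modLKer.relIndex D.DeltaXbar ≠ 0)
    (hgen : ∃ z ∈ D.inertia D.ε1, D.inertia D.ε1 ≤ (Subgroup.zpowers z).topologicalClosure)
    (hord : D.deltaEpsKer.relIndex (D.inertia D.ε1 ⊔ D.deltaEpsKer) = D.l)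
    (hind : D.inertia D.ε1 ⊓ (D.inertia D.ε2 ⊔ D.deltaEpsKer) ≤ D.deltaEpsKer)
    (hI3 : ∀ (x : D.Cusp), ∀ g ∈ D.PiXbar, ∀ z ∈ D.inertia x, g * z * g⁻¹ * z⁻¹ ∈ D.modLKer)
    (hL3 : ∀ c ∈ D.DeltaCbar, c ∉ D.DeltaXbar → ∀ v ∈ D.DeltaXbar,
      c * v * c⁻¹ * v ∈ D.inertia D.ε1 ⊔ D.inertia D.ε2 ⊔ D.deltaEpsKer)
    (hι : ∃ c ∈ D.DeltaCbar, c ∉ D.DeltaXbar) :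
    ∀ [(D.piXarrow.subgroupOf D.PiCbar).Normal], IsCyclic (D.PiCbar ⧸ D.piXarrow.subgroupOf D.PiCbar) := by
  intro hPn
  obtain ⟨z, hz, hzgen⟩ := hgen
  obtain ⟨c, hc, hcX⟩ := hι
  have hzΔ : z ∈ D.DeltaXbar := D.inertia_le_deltaXbar _ hz
  have hzC : z ∈ D.DeltaCbar := D.deltaXbar_le_deltaCbar hzΔ
  have hodd : Odd D.l := Nat.coprime_two_left.mp
    (Nat.Coprime.coprime_dvd_left (by norm_num : 2 ∣ 6) D.coprime_six.symm)
  -- the abelian group `H = Δ_C̲/jKer` of order `2l`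
  set K : Subgroup ↥D.DeltaCbar := D.jKer.subgroupOf D.DeltaCbar with hK
  haveI hKn : K.Normal := normal_subgroupOf_of_le (D.jKer_le_deltaXbar.trans D.deltaXbar_le_deltaCbar)
    D.deltaCbar_le_piCbar (C.jKer_normal_of_inertiaCentral hI3)
  have hcard : Nat.card (↥D.DeltaCbar ⧸ K) = 2 * D.l := by
    rw [← Subgroup.index_eq_card]
    exact C.jKer_relIndex_deltaCbar_of_laws hfin ⟨z, hz, hzgen⟩ hord hind hI3 hL3 ⟨c, hc, hcX⟩
  haveI : Finite (↥D.DeltaCbar ⧸ K) := by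
    apply Nat.finite_of_card_ne_zero
    rw [hcard]; exact Nat.mul_ne_zero two_ne_zero D.l_ne_zero
  have hcomm : ∀ a b : ↥D.DeltaCbar ⧸ K, a * b = b * a := by
    have hle : _root_.commutator ↥D.DeltaCbar ≤ K := by
      rw [commutator_eq_closure, Subgroup.closure_le]
      rintro _ ⟨a, b, rfl⟩
      rw [SetLike.mem_coe, hK, Subgroup.mem_subgroupOf, commutatorElement_def]
      simp only [Subgroup.coe_mul, Subgroup.coe_inv]
      exact C.commutator_mem_jKer_of_mem_deltaCbar hI3 hL3 ⟨c, hc, hcX⟩ a.2 b.2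
    have hI : IsMulCommutative (↥D.DeltaCbar ⧸ K) :=
      Subgroup.Normal.quotient_commutative_iff_commutator_le.mpr hle
    exact fun a b => hI.is_comm.comm a b
  -- orders: `z ↦ l`, `ι̲^l ↦ 2`
  have hmemK : ∀ (x : D.PiC) (hx : x ∈ D.DeltaCbar) (d : ℕ),
      (QuotientGroup.mk (⟨x, hx⟩ : ↥D.DeltaCbar) : ↥D.DeltaCbar ⧸ K) ^ d = 1 ↔ x ^ d ∈ D.jKer := by
    intro x hx d
    rw [← QuotientGroup.mk_pow, QuotientGroup.eq_one_iff, hK, Subgroup.mem_subgroupOf, Subgroup.coe_pow]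
  have hzord : ∀ d : ℕ, z ^ d ∈ D.jKer ↔ D.l ∣ d := by
    intro d
    have hsup : D.DeltaXbar ≤ Subgroup.zpowers z ⊔ D.jKer := by
      rw [← C.inertia_ε1_sup_of_laws hI3 hL3 ⟨c, hc, hcX⟩]
      exact sup_le (D.le_zpowers_sup_of_le_closure hfin D.modLKer_le_jKer D.jKer_le_deltaXbar hzΔ hzgen)
        le_sup_right
    rw [← C.jKer_relindex_of_laws hfin ⟨z, hz, hzgen⟩ hord hind hI3 hL3 ⟨c, hc, hcX⟩]
    exact relIndex_dvd_iff_of_le_zpowers_sup D.jKer_le_deltaXbar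
      (D.normal_subgroupOf_of_modLKer_le D.modLKer_le_jKer D.jKer_le_deltaXbar le_rfl) hzΔ hsup d
  have hclord : ∀ d : ℕ, (c ^ D.l) ^ d ∈ D.jKer ↔ 2 ∣ d := by
    intro d
    rw [← C.jKer_relIndex_galKer_of_laws hI3 ⟨c, hc, hcX⟩]
    have hjG : D.jKer ≤ D.galKer := le_sup_left
    exact relIndex_dvd_iff_of_le_zpowers_sup hjG
      (normal_subgroupOf_of_le hjG D.galKer_le_piCbar' (C.jKer_normal_of_inertiaCentral hI3))
      (Subgroup.mem_sup_right (Subgroup.subset_closure ⟨c, hc, rfl⟩))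
      (C.galKer_le_zpowers_sup_jKer hI3 hc hcX) d
  set qz : ↥D.DeltaCbar ⧸ K := QuotientGroup.mk ⟨z, hzC⟩ with hqz
  set qc : ↥D.DeltaCbar ⧸ K := QuotientGroup.mk ⟨c ^ D.l, D.DeltaCbar.pow_mem hc _⟩ with hqc
  have hoz : orderOf qz = D.l := by
    refine Nat.dvd_antisymm (orderOf_dvd_of_pow_eq_one ((hmemK z hzC D.l).mpr ((hzord _).mpr (dvd_refl _))))
      ((hzord _).mp ((hmemK z hzC _).mp (pow_orderOf_eq_one qz)))
  have hoc : orderOf qc = 2 := by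
    have h2 : qc ^ 2 = 1 := (hmemK _ _ 2).mpr ((hclord 2).mpr (dvd_refl _))
    exact Nat.dvd_antisymm (orderOf_dvd_of_pow_eq_one h2)
      ((hclord _).mp ((hmemK (c ^ D.l) (D.DeltaCbar.pow_mem hc _) (orderOf qc)).mp (pow_orderOf_eq_one qc)))
  have hcop : (orderOf qz).Coprime (orderOf qc) := by
    rw [hoz, hoc]
    exact Nat.Coprime.coprime_dvd_right (by norm_num : 2 ∣ 6) D.coprime_six
  have hprod : orderOf (qz * qc) = Nat.card (↥D.DeltaCbar ⧸ K) := by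
    rw [(show Commute qz qc from hcomm qz qc).orderOf_mul_eq_mul_orderOf_of_coprime hcop, hoz, hoc, hcard,
      mul_comm]
  haveI hcyc : IsCyclic (↥D.DeltaCbar ⧸ K) := isCyclic_of_orderOf_eq_card _ hprod
  -- `Δ_C̲/jKer ↠ Π_C̲/Π_{X̲→}`
  have hle : K ≤ (D.piXarrow.subgroupOf D.PiCbar).comap (Subgroup.inclusion D.deltaCbar_le_piCbar) := by
    intro x hx
    rw [Subgroup.mem_comap, Subgroup.mem_subgroupOf]
    rw [hK, Subgroup.mem_subgroupOf] at hx
    exact (D.jKer_le_piXarrow_inf_delta.trans inf_le_left) hx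
  refine isCyclic_of_surjective (QuotientGroup.map K (D.piXarrow.subgroupOf D.PiCbar)
    (Subgroup.inclusion D.deltaCbar_le_piCbar) hle) ?_
  intro y
  induction y using QuotientGroup.induction_on with
  | H g =>
    obtain ⟨p, hp, δ, hδ, hpδ⟩ := D.exists_piXarrow_mul_deltaCbar g.2
    refine ⟨QuotientGroup.mk ⟨δ, hδ⟩, ?_⟩
    rw [QuotientGroup.map_mk, QuotientGroup.eq]
    rw [Subgroup.mem_subgroupOf]
    change ((Subgroup.inclusion D.deltaCbar_le_piCbar ⟨δ, hδ⟩ : ↥D.PiCbar) : D.PiC)⁻¹ * (g : D.PiC) ∈ D.piXarrow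
    simp only [Subgroup.coe_inclusion]
    rw [← hpδ]
    have e : δ⁻¹ * (p * δ) = δ⁻¹ * p * δ⁻¹⁻¹ := by group
    rw [e]
    exact (Subgroup.normal_subgroupOf_iff D.piXarrow_le_piCbar).mp hPn p δ⁻¹ hp
      (D.PiCbar.inv_mem (D.deltaCbar_le_piCbar hδ))

include C in
/-- **[IUTchI] §1 p. 38 — the typed clause `ArrowCoveringClaims.galC_cyclic` (`Gal(C̲→/C̲) ≅ ℤ/lℤ` is CYCLIC)
DERIVED** (a quotient of the cyclic `Π_C̲/Π_{X̲→}`). ([IUTchI] §1 p.38) [claim: Mochizuki2012, status: disputed] -/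
theorem galC_cyclic_of_laws
    (hfin : D.modLKer.relIndex D.DeltaXbar ≠ 0)
    (hgen : ∃ z ∈ D.inertia D.ε1, D.inertia D.ε1 ≤ (Subgroup.zpowers z).topologicalClosure)
    (hord : D.deltaEpsKer.relIndex (D.inertia D.ε1 ⊔ D.deltaEpsKer) = D.l)
    (hind : D.inertia D.ε1 ⊓ (D.inertia D.ε2 ⊔ D.deltaEpsKer) ≤ D.deltaEpsKer)
    (hI3 : ∀ (x : D.Cusp), ∀ g ∈ D.PiXbar, ∀ z ∈ D.inertia x, g * z * g⁻¹ * z⁻¹ ∈ D.modLKer)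
    (hL3 : ∀ c ∈ D.DeltaCbar, c ∉ D.DeltaXbar → ∀ v ∈ D.DeltaXbar,
      c * v * c⁻¹ * v ∈ D.inertia D.ε1 ⊔ D.inertia D.ε2 ⊔ D.deltaEpsKer)
    (hι : ∃ c ∈ D.DeltaCbar, c ∉ D.DeltaXbar) :
    ∀ [(D.piCarrow.subgroupOf D.PiCbar).Normal], IsCyclic (D.PiCbar ⧸ D.piCarrow.subgroupOf D.PiCbar) := by
  intro hCn
  haveI hXn := C.piXarrow_normal_of_laws hI3 hL3 hι
  haveI := C.galX_cyclic_of_laws hfin hgen hord hind hI3 hL3 hι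
  have hle : D.piXarrow.subgroupOf D.PiCbar ≤ (D.piCarrow.subgroupOf D.PiCbar).comap (MonoidHom.id _) := by
    intro x hx
    rw [Subgroup.mem_comap, MonoidHom.id_apply, Subgroup.mem_subgroupOf]
    exact D.piXarrow_le_piCarrow (Subgroup.mem_subgroupOf.mp hx)
  refine isCyclic_of_surjective (QuotientGroup.map _ _ (MonoidHom.id _) hle) ?_
  intro y
  induction y using QuotientGroup.induction_on with
  | H g => exact ⟨QuotientGroup.mk g, by rw [QuotientGroup.map_mk, MonoidHom.id_apply]⟩

end CuspGalois

end PuncturedEllipticData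

end Literature.IUT.HodgeTheaters
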